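import Literature.AlgebraicGeometry.Resolution.LogRefinedChartRegular
import Literature.AlgebraicGeometry.Resolution.LogBlowupChart
import HarnessLib

/-!
# Crux `FrobeniusLadder.FRationalResolution` (stmt-ResolutionOfSingularities-15317), line `redirect`,
# stub `stub_diagonalizableQuotientResolution` — **orthant points of a chart algebra are regular**
# (point-blow-up recursion for the surface case over arbitrary fields, memo MEMO-15317-leafhand2-g6
# §3–§4: the ring-level input at the NON-fixed points of the blow-up charts and at the free charts)

Generic log geometry over the tree's Kato (10.3) engine (`LogRefinedChartRegular.lean`,
`LogRefinedChart.isRegularLocalRing_localization_chartAlgebra`: the local rings of an `A`-algebra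
`C = A[χ(Q)]` generated by a chart `χ : Q → C` extending a log regular fs chart `φ : P → A` along
`P ≤ Q`, `Q = ℕ^I ⊕ ℤ^{Iᶜ}` ORTHANT-LIKE, are regular). Two repackagings needed by the point-blow-up
recursion, where the chart monoids `Q = P_a` of the blow-up charts `A[I/φ(a)] = A[χ(P_a)]`
(`LogChart.blowupChart`) are NOT orthant-like but their localisations at the faces of the non-fixed
points are:

* `isRegularLocalRing_localization_of_isOrthantLike` — the tree's theorem with log regularity of `φ`
  required ONLY AT THE IMAGE PRIME `𝔓 ∩ A` (its proof uses nothing more); so iterated charts over one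
  log regular point `x ∈ Spec A` can be fed to it without log regularity of the intermediate blow-ups;
* **`isRegularLocalRing_localization_of_isOrthantLike_awayMonoid`** — if `χ(g)` is a unit at `𝔓`
  (`g ∈ Q` in the unit face of `χ` at `𝔓`) and the localised monoid `Q⟨−g⟩ = {v : v + kg ∈ Q}`
  (`LogChart.awayMonoid`) is orthant-like, then `C_𝔓` is a regular local ring: `C_𝔓` is a local ring of
  `C[χ(g)⁻¹]`, which is generated over `A` by the localised chart `Φ_g : Q⟨−g⟩ → C[χ(g)⁻¹]`
  (`LogChart.awayChart`) extending `φ`, with the field-extension property inherited from `C` (hypothesis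
  (D): `g + p ∈ P` for some `p ∈ P`, so `χ(g)` divides a chart element of `φ` and is non-zero in every
  field where `φ(P)` is).

In the surface recursion: the two end charts and the interior charts with coefficient `b ≤ 3` are
orthant-like outright; on an interior chart with `b ≥ 4` every point over `x` other than the torus-fixed
point has a ray of the chart cone in its unit face, and the localisation at that ray is `ℕ ⊕ ℤ`.
Honest label: plumbing over the tree's Kato (10.3) pipeline toward ONE leaf stub (no stub, crux or summit
closed). No definitions, no named facts, no sorry. [cite: Kato1994, (10.1), (10.3)] [cite: Niziol2006, §4]
-/

noncomputable section

-- single-problem summit: the doubled namespace component is forced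
set_option linter.dupNamespace false

open IsLocalRing Literature.AlgebraicGeometry.Resolution Literature.AlgebraicGeometry.Resolution.LogChart
  Literature.AlgebraicGeometry.Resolution.LogRefinedChart

namespace Summit.ResolutionOfSingularities.ResolutionOfSingularities.Theorems.FRationalResolution.ChartAlgebraOrthantPoints

universe u

variable {A : Type u} [CommRing A] [IsNoetherianRing A] {n : ℕ} {P : AddSubmonoid (Fin n → ℤ)}
  {φ : Multiplicative P →* A} {C : Type u} [CommRing C] [Algebra A C] {Q : AddSubmonoid (Fin n → ℤ)}
  {χ : Multiplicative Q →* C}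

/-- **Kato (10.3), one prime at a time.** As `LogRefinedChart.isRegularLocalRing_localization_chartAlgebra`
(orthant-like chart algebra over a log regular fs chart ⇒ regular local rings), but assuming log
regularity of the base chart `φ` only at the image prime `𝔓 ∩ A` of the prime `𝔓` under inspection —
which is all its proof uses. [cite: Kato1994, (10.3)] -/
theorem isRegularLocalRing_localization_of_isOrthantLike (hP : P.FG)
    (hsat : ∀ (v : Fin n → ℤ) (k : ℕ), 0 < k → k • v ∈ P → v ∈ P)
    (hspan : Submodule.span ℤ (P : Set (Fin n → ℤ)) = ⊤)
    {b : Module.Basis (Fin n) ℤ (Fin n → ℤ)} {I : Finset (Fin n)} (hQ : IsOrthantLike b I Q)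
    (hPQ : P ≤ Q)
    (hχ : ∀ p : P, χ (Multiplicative.ofAdd ⟨(p : Fin n → ℤ), hPQ p.2⟩) =
      algebraMap A C (φ (Multiplicative.ofAdd p)))
    (hgen : Algebra.adjoin A (Set.range χ) = ⊤)
    (hΩ : ∀ (L : Type u) [Field L] (g : A →+* L), (∀ p : P, g (φ (Multiplicative.ofAdd p)) ≠ 0) →
      ∃ ω : C →+* L, ω.comp (algebraMap A C) = g)
    (𝔓 : Ideal C) [𝔓.IsPrime] (hreg : IsLogRegularAt P φ (𝔓.comap (algebraMap A C))) :
    IsRegularLocalRing (Localization.AtPrime 𝔓) := by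
  have hface := LogChart.isFaceOf_faceMonoid P φ (𝔓.comap (algebraMap A C))
  obtain ⟨e, he⟩ := LogChart.exists_isSharpEmbedding hP hface hsat
  obtain ⟨π₀, hπ₀0, hπ₀1, hπ₀2⟩ := hface.exists_proj hsat
  have ℌ : Hyps P φ Q χ 𝔓 π₀ := ⟨hPQ, hχ, hπ₀0, hπ₀1, hπ₀2, hspan, hP⟩
  obtain ⟨𝒟⟩ := nonempty_pointData hQ χ 𝔓 hPQ hχ π₀ hπ₀0 hπ₀1 he hP hreg
  obtain ⟨ω, hω⟩ := hΩ (Frac ℌ 𝒟) (gA ℌ 𝒟) (gA_phi_ne_zero ℌ 𝒟)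
  exact isRegularLocalRing_of_hyps ℌ 𝒟 ω hω hgen

omit [IsNoetherianRing A] in
/-- In a field, a chart algebra map kills no `χ(g)` dividing a chart element of the base:
if `ω ∘ (A → C) = g₀` with `g₀(φ(P)) ∌ 0` and `g + p ∈ P` for some `p ∈ P`, then `ω(χ(g)) ≠ 0`.
[folklore] -/
theorem map_chi_ne_zero (hPQ : P ≤ Q)
    (hχ : ∀ p : P, χ (Multiplicative.ofAdd ⟨(p : Fin n → ℤ), hPQ p.2⟩) =
      algebraMap A C (φ (Multiplicative.ofAdd p)))
    {L : Type u} [Field L] {g₀ : A →+* L} (hg₀ : ∀ p : P, g₀ (φ (Multiplicative.ofAdd p)) ≠ 0)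
    {ω : C →+* L} (hω : ω.comp (algebraMap A C) = g₀) {g : Q} {p : Fin n → ℤ} (hp : p ∈ P)
    (hgp : (g : Fin n → ℤ) + p ∈ P) : ω (χ (Multiplicative.ofAdd g)) ≠ 0 := by
  intro h0
  apply hg₀ ⟨(g : Fin n → ℤ) + p, hgp⟩
  have h1 : χ (Multiplicative.ofAdd (⟨(g : Fin n → ℤ) + p, hPQ hgp⟩ : Q)) =
      χ (Multiplicative.ofAdd g) * χ (Multiplicative.ofAdd ⟨p, hPQ hp⟩) := by
    rw [← map_mul, ← ofAdd_add]; rfl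
  rw [← hω, RingHom.comp_apply, ← hχ ⟨(g : Fin n → ℤ) + p, hgp⟩, h1, map_mul, h0, zero_mul]

/-- **Orthant points are regular.** Let `φ : P → A` be an fs chart (`P ⊆ ℤⁿ` finitely generated,
saturated, spanning; `A` Noetherian) and `C = A[χ(Q)]` a chart algebra over it (`χ : Q → C` extending
`φ` along `P ≤ Q`, generating `C`, with the field-extension property and denominators (D)). Let `𝔓`
be a prime of `C` such that `φ` is log regular at `𝔓 ∩ A`, and `g ∈ Q` with `χ(g) ∉ 𝔓`. If the
localised monoid `Q⟨−g⟩` is orthant-like (`ℕ^I ⊕ ℤ^{Iᶜ}` in some `ℤ`-basis), then `C_𝔓` is a regular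
local ring (Kato (10.3) applied to the chart `Φ_g : Q⟨−g⟩ → C[χ(g)⁻¹]`, of which `C_𝔓` is a local
ring). [cite: Kato1994, (10.1), (10.3)] [cite: Niziol2006, §4] -/
theorem isRegularLocalRing_localization_of_isOrthantLike_awayMonoid (hP : P.FG)
    (hsat : ∀ (v : Fin n → ℤ) (k : ℕ), 0 < k → k • v ∈ P → v ∈ P)
    (hspan : Submodule.span ℤ (P : Set (Fin n → ℤ)) = ⊤) (hPQ : P ≤ Q)
    (hχ : ∀ p : P, χ (Multiplicative.ofAdd ⟨(p : Fin n → ℤ), hPQ p.2⟩) =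
      algebraMap A C (φ (Multiplicative.ofAdd p)))
    (hgen : Algebra.adjoin A (Set.range χ) = ⊤)
    (hΩ : ∀ (L : Type u) [Field L] (g : A →+* L), (∀ p : P, g (φ (Multiplicative.ofAdd p)) ≠ 0) →
      ∃ ω : C →+* L, ω.comp (algebraMap A C) = g)
    (hD : ∀ q ∈ Q, ∃ p ∈ P, q + p ∈ P)
    (𝔓 : Ideal C) [𝔓.IsPrime] (hreg : IsLogRegularAt P φ (𝔓.comap (algebraMap A C)))
    (g : Q) (hg : χ (Multiplicative.ofAdd g) ∉ 𝔓)
    {b : Module.Basis (Fin n) ℤ (Fin n → ℤ)} {I : Finset (Fin n)} (hQg : IsOrthantLike b I (awayMonoid Q g)) :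
    IsRegularLocalRing (Localization.AtPrime 𝔓) := by
  classical
  set x : C := χ (Multiplicative.ofAdd g) with hxdef
  -- the localised chart algebra `C' = C[1/x]` with chart `Φ_g : Q⟨−g⟩ → C'`
  let C' : Type u := Localization.Away x
  let χ' : Multiplicative (awayMonoid Q g) →* C' := awayChart Q χ g
  -- the prime `𝔓 C'`
  have hdisj : Disjoint ((Submonoid.powers x : Submonoid C) : Set C) (𝔓 : Set C) := by
    rw [Set.disjoint_left]
    rintro y ⟨k, rfl⟩ hy
    exact hg (Ideal.IsPrime.mem_of_pow_mem ‹_› k hy)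
  haveI h𝔓' : (𝔓.map (algebraMap C C')).IsPrime :=
    IsLocalization.isPrime_of_isPrime_disjoint (Submonoid.powers x) C' 𝔓 ‹_› hdisj
  have hcomap : (𝔓.map (algebraMap C C')).comap (algebraMap C C') = 𝔓 :=
    IsLocalization.under_map_of_isPrime_disjoint (Submonoid.powers x) C' ‹_› hdisj
  -- hypotheses of Kato (10.3) for `(C', Q⟨−g⟩, Φ_g)`
  have hcomapA : (𝔓.map (algebraMap C C')).comap (algebraMap A C') = 𝔓.comap (algebraMap A C) := by
    rw [IsScalarTower.algebraMap_eq A C C', ← Ideal.comap_comap, hcomap]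
  have hreg' : IsLogRegularAt P φ ((𝔓.map (algebraMap C C')).comap (algebraMap A C')) := by
    have key : ∀ (𝔮 : Ideal A) [𝔮.IsPrime], 𝔮 = 𝔓.comap (algebraMap A C) → IsLogRegularAt P φ 𝔮 := by
      intro 𝔮 _ h
      subst h
      exact hreg
    exact key _ hcomapA
  have hPQ' : P ≤ awayMonoid Q g := hPQ.trans (le_awayMonoid Q g)
  have hχ'Q : ∀ q : Q, χ' (Multiplicative.ofAdd ⟨(q : Fin n → ℤ), le_awayMonoid Q g q.2⟩) =
      algebraMap C C' (χ (Multiplicative.ofAdd q)) := fun q => awayChart_of_mem Q χ g q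
  have hχ' : ∀ p : P, χ' (Multiplicative.ofAdd ⟨(p : Fin n → ℤ), hPQ' p.2⟩) =
      algebraMap A C' (φ (Multiplicative.ofAdd p)) := by
    intro p
    rw [IsScalarTower.algebraMap_apply A C C', ← hχ p]
    exact hχ'Q ⟨(p : Fin n → ℤ), hPQ p.2⟩
  have hgen' : Algebra.adjoin A (Set.range χ') = ⊤ := by
    -- `C ⊆ adjoin`: the image of `adjoin A (range χ) = ⊤`
    have hC : ∀ c : C, algebraMap C C' c ∈ Algebra.adjoin A (Set.range χ') := by
      intro c
      have hc : c ∈ Algebra.adjoin A (Set.range χ) := by rw [hgen]; exact Algebra.mem_top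
      have h1 : (Algebra.adjoin A (Set.range χ)).map (IsScalarTower.toAlgHom A C C') ≤
          Algebra.adjoin A (Set.range χ') := by
        rw [AlgHom.map_adjoin]
        refine Algebra.adjoin_mono ?_
        rintro _ ⟨_, ⟨q, rfl⟩, rfl⟩
        refine ⟨Multiplicative.ofAdd ⟨((Multiplicative.toAdd q : Q) : Fin n → ℤ),
          le_awayMonoid Q g (Multiplicative.toAdd q).2⟩, ?_⟩
        rw [IsScalarTower.coe_toAlgHom']
        exact hχ'Q (Multiplicative.toAdd q)
      exact h1 ⟨c, hc, rfl⟩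
    -- the inverse of `x` is the chart element `Φ_g(−g)`
    have hinv : χ' (Multiplicative.ofAdd ⟨-(g : Fin n → ℤ), neg_mem_awayMonoid Q g⟩) *
        algebraMap C C' x = 1 := awayChart_neg_mul_algebraMap Q χ g
    refine top_le_iff.1 fun z _ => ?_
    obtain ⟨⟨c, s⟩, rfl⟩ := IsLocalization.mk'_surjective (M := Submonoid.powers x) (S := C') z
    obtain ⟨k, hk⟩ := (Submonoid.mem_powers_iff _ _).1 s.2
    have hs : IsLocalization.mk' C' (1 : C) s =
        χ' (Multiplicative.ofAdd ⟨-(g : Fin n → ℤ), neg_mem_awayMonoid Q g⟩) ^ k := by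
      have hu : IsUnit (algebraMap C C' (s : C)) := IsLocalization.map_units C' s
      refine (hu.mul_left_inj).1 ?_
      rw [IsLocalization.mk'_spec, map_one]
      change _ = _ * algebraMap C C' (s : C)
      rw [← hk, map_pow, ← mul_pow, hinv, one_pow]
    change IsLocalization.mk' C' c s ∈ _
    rw [IsLocalization.mk'_eq_mul_mk'_one, hs]
    refine Subalgebra.mul_mem _ (hC c) (Subalgebra.pow_mem _ ?_ k)
    exact Algebra.subset_adjoin (Set.mem_range_self _)
  have hΩ' : ∀ (L : Type u) [Field L] (g₀ : A →+* L), (∀ p : P, g₀ (φ (Multiplicative.ofAdd p)) ≠ 0) →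
      ∃ ω : C' →+* L, ω.comp (algebraMap A C') = g₀ := by
    intro L _ g₀ hg₀
    obtain ⟨ω, hω⟩ := hΩ L g₀ hg₀
    obtain ⟨p, hp, hgp⟩ := hD _ g.2
    have hx : IsUnit (ω x) := (map_chi_ne_zero hPQ hχ hg₀ hω hp hgp).isUnit
    refine ⟨IsLocalization.Away.lift x hx, ?_⟩
    rw [IsScalarTower.algebraMap_eq A C C', ← RingHom.comp_assoc, IsLocalization.Away.lift_comp, hω]
  -- Kato (10.3) on `C'` at `𝔓 C'`, transported back along `C_𝔓 ≅ C'_{𝔓C'}`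
  have hR : IsRegularLocalRing (Localization.AtPrime (𝔓.map (algebraMap C C'))) :=
    isRegularLocalRing_localization_of_isOrthantLike hP hsat hspan hQg hPQ' hχ' hgen' hΩ' _ hreg'
  have h1 : IsRegularLocalRing
      (Localization.AtPrime ((𝔓.map (algebraMap C C')).comap (algebraMap C C'))) := by
    haveI := hR
    exact IsRegularLocalRing.of_ringEquiv
      (IsLocalization.localizationLocalizationAtPrimeIsoLocalization (Submonoid.powers x)
        (𝔓.map (algebraMap C C'))).symm.toRingEquiv
  have key : ∀ (𝔔 : Ideal C) [𝔔.IsPrime], 𝔔 = 𝔓 →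
      IsRegularLocalRing (Localization.AtPrime 𝔔) → IsRegularLocalRing (Localization.AtPrime 𝔓) := by
    intro 𝔔 _ h h𝔔
    subst h
    exact h𝔔
  exact key _ hcomap h1

end Summit.ResolutionOfSingularities.ResolutionOfSingularities.Theorems.FRationalResolution.ChartAlgebraOrthantPoints

end
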